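import Mathlib
import HarnessLib
import Summits.HubbardSuperconductivity.HubbardSuperconductivity.Theorems.KLProgrammeC4aTangencyCurvature
import Summits.HubbardSuperconductivity.HubbardSuperconductivity.Theorems.KLProgrammeC4aTangencyCurvatureFloor
import Summits.HubbardSuperconductivity.HubbardSuperconductivity.Theorems.KLProgrammeC4aPartnerBandCooperDefect

/-!
# Route `KLProgramme` — crux C4a, S3 brick (B2, TANGENCY, TWO-SIDED VALUE): near the tangency configurations the partner band is `b_T(θ)·φ²` up to
# `C₃|φ|³ + K₁|e|/d + K₁(|ρ|/d + D₁|ϑ − ϑ_T|)`, hence BOUNDED BELOW by `(3/200)·u_min²·φ² − (the same errors)` under `FrameOK`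

Cell `gate-hubbard-kl`, lane hubbard-kl-c4a-1 (g6); helper for stub (C) `stub_twoLeg_curvature` of the engine-flow child `KLRegimeEngineV17F2`
(stmt-HubbardSuperconductivity-20437); memo HOME/hubbard-kl-c4a-1/C4A-PLAN.md §24.4 (ii), §24.8 (i), §24.9.  This is the form (B4)-(T) consumes for the measure of the crossing region
`{|ē| ≲ 2^{−J}} ⊂ {φ² ≲ 2^{−J} + |e| + δ}`: the `O(|e|)` slack is of the order of the shell itself, so the sharper slope `ē ≈ −e` (which would need the second
level-derivative of the Fermi radius) is not required.  Ingredients: `abs_partnerBand_pp/ph_tangency_sub_curv_le` (at `e = 0`, exact configuration), the order-0 reductions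
`e → 0`, `(ρ,ϑ) → ϑ_T` by `abs_frameLevel_sub_le` + `norm_levelPoint_sub_levelPoint_le` + `norm_pairDiffPath_zero_le` / `norm_pairSumPath_zero_le`, and the floor
`curvCoeff_ge_umin_sq_of_frameOK`.

* **`abs_partnerBand_pp_sub_curv_le`**, **`abs_partnerBand_ph_sub_curv_le`** — `|ē − φ²·b_T(θ)| ≤ C₃|φ|³ + K₁|e|/d + K₁(|ρ|/d + D₁|ϑ − ϑ_T|)` for all admissible `(e,ρ,ϑ)`;
* **`partnerBand_pp_tangency_lower`**, **`partnerBand_ph_tangency_lower`** — under `FrameOK R U N μ K`: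
  `(3/200)·u_min²·φ² − C₃|φ|³ − K₁|e|/d − K₁(|ρ|/d + D₁|ϑ − ϑ_T|) ≤ |ē|`.

Bookkeeping on landed objects; nothing about the model's sizes; nothing asserts superconductivity.  References: FST II CPAM 51 (1998) Lemma 2.1, §3 [cite: FeldmanSalmhoferTrubowitz1998];
BGM 2006 §2.4 (2.40) [cite: BenfattoGiulianiMastropietro2006].
-/

noncomputable section

namespace Summit.HubbardSuperconductivity.HubbardSuperconductivity.Theorems.C4a

set_option linter.dupNamespace false -- summit = problem name (single-conjunct summit), D-0017

open Real Set Filter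
open scoped Topology
open Literature.MathematicalPhysics.QuantumLattice Literature.MathematicalPhysics.QuantumLattice.BandSectorCounting Literature.Probability.LatticeModels
open Summit.HubbardSuperconductivity.HubbardSuperconductivity.Theorems.KLRegimeSplit
open Summit.HubbardSuperconductivity.HubbardSuperconductivity.Theorems.DispersionFlow
open Summit.HubbardSuperconductivity.HubbardSuperconductivity.Theorems.PerturbedFermiCurve

section Sizes

variable {K : TrigPolyC4v} {A : ℝ} (hA : ∀ p : Momentum, ∀ j ≤ 2, ‖iteratedFDeriv ℝ j (frameShift K) p‖ ≤ A) (hA20 : A ≤ 1 / 20)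
  (hd : klCurveD ≤ (bandBounds (show (-4 : ℝ) < -1.1 by norm_num) (show (-1.1 : ℝ) ≤ -0.1 by norm_num)
    (show (-0.1 : ℝ) < 0 by norm_num)).Dtmin - 2 * A)
  {μ r : ℝ} (hr : 0 < r) (hlo : (-1.1 : ℝ) < μ - r - A) (hhi : μ + r + A < -0.1)
  {A₃ A₄ : ℝ} (hA₃ : ∀ p : Momentum, ‖iteratedFDeriv ℝ 3 (frameShift K) p‖ ≤ A₃)
  (hA₄ : ∀ p : Momentum, ‖iteratedFDeriv ℝ 4 (frameShift K) p‖ ≤ A₄)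
  {K₁ K₂ K₃ : ℝ} (hK₁ : ∀ p : Momentum, ‖fderiv ℝ (frameLevel μ K) p‖ ≤ K₁) (hK₂ : ∀ p : Momentum, ‖iteratedFDeriv ℝ 2 (frameLevel μ K) p‖ ≤ K₂)
  (hK₃ : ∀ p : Momentum, ‖iteratedFDeriv ℝ 3 (frameLevel μ K) p‖ ≤ K₃)
include hA hA20 hd hr hlo hhi hA₃ hA₄ hK₁ hK₂ hK₃

/-- **TWO-SIDED VALUE OF THE pp PARTNER BAND NEAR TANGENCY**: for `|e| < r`, `|ρ| < r` and all `ϑ, θ, φ`,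
`|e_K(S_{ρ,ϑ,θ}(0) − Φ(e, φ+θ)) − φ²·b_T(θ)| ≤ C₃|φ|³ + K₁|e|/d + K₁(|ρ|/d + D₁|ϑ|)`. -/
theorem abs_partnerBand_pp_sub_curv_le {ρ : ℝ} (hρ : |ρ| < r) {e : ℝ} (he : |e| < r) (ϑ θ φ : ℝ) :
    |frameLevel μ K (pairSumPath μ K ρ ϑ θ 0 - levelPoint μ K e (φ + θ)) - φ ^ 2 * fderiv ℝ (fderiv ℝ (frameLevel μ K)) (levelPoint μ K 0 θ) (iteratedDeriv 1 (levelPoint μ K 0) θ) (iteratedDeriv 1 (levelPoint μ K 0) θ)| ≤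
      (K₃ * msD A₃ A₄ 1 ^ 3 + 3 * K₂ * msD A₃ A₄ 1 * msD A₃ A₄ 2 + K₁ * msD A₃ A₄ 3) * |φ| ^ 3 + K₁ * (|e| / ((bandBounds (show (-4 : ℝ) < -1.1 by norm_num) (show (-1.1 : ℝ) ≤ -0.1 by norm_num) (show (-0.1 : ℝ) < 0 by norm_num)).Dtmin - 2 * A)) +
        K₁ * (|ρ| / ((bandBounds (show (-4 : ℝ) < -1.1 by norm_num) (show (-1.1 : ℝ) ≤ -0.1 by norm_num) (show (-0.1 : ℝ) < 0 by norm_num)).Dtmin - 2 * A) + msD A₃ A₄ 1 * |ϑ|) := by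
  set B₀ := bandBounds (show (-4 : ℝ) < -1.1 by norm_num) (show (-1.1 : ℝ) ≤ -0.1 by norm_num) (show (-0.1 : ℝ) < 0 by norm_num) with hB₀
  have hADt : 2 * A < B₀.Dtmin := by have := klCurveD_pos; linarith
  have hK₁0 : 0 ≤ K₁ := (norm_nonneg _).trans (hK₁ 0)
  have step1 : |frameLevel μ K (pairSumPath μ K ρ ϑ θ 0 - levelPoint μ K e (φ + θ)) - frameLevel μ K (pairSumPath μ K ρ ϑ θ 0 - levelPoint μ K 0 (φ + θ))| ≤
      K₁ * (|e| / (B₀.Dtmin - 2 * A)) := by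
    refine (abs_frameLevel_sub_le hK₁ _ _).trans (mul_le_mul_of_nonneg_left ?_ hK₁0)
    rw [show pairSumPath μ K ρ ϑ θ 0 - levelPoint μ K e (φ + θ) - (pairSumPath μ K ρ ϑ θ 0 - levelPoint μ K 0 (φ + θ)) =
      -(levelPoint μ K e (φ + θ) - levelPoint μ K 0 (φ + θ)) by abel, norm_neg]
    have h := norm_levelPoint_sub_levelPoint_le B₀ hA hADt hlo hhi (ρ := e) (ρ' := 0) ⟨(abs_lt.1 he).1, (abs_lt.1 he).2⟩ ⟨by linarith, hr⟩ (φ + θ)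
    rwa [sub_zero] at h
  have step2 : |frameLevel μ K (pairSumPath μ K ρ ϑ θ 0 - levelPoint μ K 0 (φ + θ)) - frameLevel μ K (pairSumPath μ K 0 0 θ 0 - levelPoint μ K 0 (φ + θ))| ≤
      K₁ * (|ρ| / (B₀.Dtmin - 2 * A) + msD A₃ A₄ 1 * |ϑ|) := by
    refine (abs_frameLevel_sub_le hK₁ _ _).trans (mul_le_mul_of_nonneg_left ?_ hK₁0)
    rw [show pairSumPath μ K ρ ϑ θ 0 - levelPoint μ K 0 (φ + θ) - (pairSumPath μ K 0 0 θ 0 - levelPoint μ K 0 (φ + θ)) = -pairDiffPath μ K ρ ϑ θ 0 by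
      simp only [pairSumPath, pairDiffPath, zero_add, add_zero]; abel, norm_neg]
    exact norm_pairDiffPath_zero_le hA hA20 hd hr hlo hhi hA₃ hA₄ hρ ϑ θ
  have step3 := abs_partnerBand_pp_tangency_sub_curv_le hA hA20 hd hr hlo hhi hA₃ hA₄ hK₁ hK₂ hK₃ θ φ
  have e1 : frameLevel μ K (pairSumPath μ K ρ ϑ θ 0 - levelPoint μ K e (φ + θ)) - φ ^ 2 * fderiv ℝ (fderiv ℝ (frameLevel μ K)) (levelPoint μ K 0 θ) (iteratedDeriv 1 (levelPoint μ K 0) θ) (iteratedDeriv 1 (levelPoint μ K 0) θ) =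
      (frameLevel μ K (pairSumPath μ K ρ ϑ θ 0 - levelPoint μ K e (φ + θ)) - frameLevel μ K (pairSumPath μ K ρ ϑ θ 0 - levelPoint μ K 0 (φ + θ))) +
        (frameLevel μ K (pairSumPath μ K ρ ϑ θ 0 - levelPoint μ K 0 (φ + θ)) - frameLevel μ K (pairSumPath μ K 0 0 θ 0 - levelPoint μ K 0 (φ + θ))) +
        (frameLevel μ K (pairSumPath μ K 0 0 θ 0 - levelPoint μ K 0 (φ + θ)) - φ ^ 2 * fderiv ℝ (fderiv ℝ (frameLevel μ K)) (levelPoint μ K 0 θ) (iteratedDeriv 1 (levelPoint μ K 0) θ) (iteratedDeriv 1 (levelPoint μ K 0) θ)) := by ring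
  rw [e1]
  refine (abs_add_three _ _ _).trans ?_
  linarith

/-- **TWO-SIDED VALUE OF THE ph PARTNER BAND NEAR `2k_F`**: `|e_K(Φ(e, φ+θ) − D_{ρ,ϑ,θ}(0)) − φ²·b_T(θ)| ≤ C₃|φ|³ + K₁|e|/d + K₁(|ρ|/d + D₁|ϑ − π|)`. -/
theorem abs_partnerBand_ph_sub_curv_le {ρ : ℝ} (hρ : |ρ| < r) {e : ℝ} (he : |e| < r) (ϑ θ φ : ℝ) :
    |frameLevel μ K (levelPoint μ K e (φ + θ) - pairDiffPath μ K ρ ϑ θ 0) - φ ^ 2 * fderiv ℝ (fderiv ℝ (frameLevel μ K)) (levelPoint μ K 0 θ) (iteratedDeriv 1 (levelPoint μ K 0) θ) (iteratedDeriv 1 (levelPoint μ K 0) θ)| ≤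
      (K₃ * msD A₃ A₄ 1 ^ 3 + 3 * K₂ * msD A₃ A₄ 1 * msD A₃ A₄ 2 + K₁ * msD A₃ A₄ 3) * |φ| ^ 3 + K₁ * (|e| / ((bandBounds (show (-4 : ℝ) < -1.1 by norm_num) (show (-1.1 : ℝ) ≤ -0.1 by norm_num) (show (-0.1 : ℝ) < 0 by norm_num)).Dtmin - 2 * A)) +
        K₁ * (|ρ| / ((bandBounds (show (-4 : ℝ) < -1.1 by norm_num) (show (-1.1 : ℝ) ≤ -0.1 by norm_num) (show (-0.1 : ℝ) < 0 by norm_num)).Dtmin - 2 * A) + msD A₃ A₄ 1 * |ϑ - π|) := by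
  set B₀ := bandBounds (show (-4 : ℝ) < -1.1 by norm_num) (show (-1.1 : ℝ) ≤ -0.1 by norm_num) (show (-0.1 : ℝ) < 0 by norm_num) with hB₀
  have hADt : 2 * A < B₀.Dtmin := by have := klCurveD_pos; linarith
  have hK₁0 : 0 ≤ K₁ := (norm_nonneg _).trans (hK₁ 0)
  have step1 : |frameLevel μ K (levelPoint μ K e (φ + θ) - pairDiffPath μ K ρ ϑ θ 0) - frameLevel μ K (levelPoint μ K 0 (φ + θ) - pairDiffPath μ K ρ ϑ θ 0)| ≤
      K₁ * (|e| / (B₀.Dtmin - 2 * A)) := by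
    refine (abs_frameLevel_sub_le hK₁ _ _).trans (mul_le_mul_of_nonneg_left ?_ hK₁0)
    rw [show levelPoint μ K e (φ + θ) - pairDiffPath μ K ρ ϑ θ 0 - (levelPoint μ K 0 (φ + θ) - pairDiffPath μ K ρ ϑ θ 0) =
      levelPoint μ K e (φ + θ) - levelPoint μ K 0 (φ + θ) by abel]
    have h := norm_levelPoint_sub_levelPoint_le B₀ hA hADt hlo hhi (ρ := e) (ρ' := 0) ⟨(abs_lt.1 he).1, (abs_lt.1 he).2⟩ ⟨by linarith, hr⟩ (φ + θ)
    rwa [sub_zero] at h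
  have step2 : |frameLevel μ K (levelPoint μ K 0 (φ + θ) - pairDiffPath μ K ρ ϑ θ 0) - frameLevel μ K (levelPoint μ K 0 (φ + θ) - pairDiffPath μ K 0 π θ 0)| ≤
      K₁ * (|ρ| / (B₀.Dtmin - 2 * A) + msD A₃ A₄ 1 * |ϑ - π|) := by
    refine (abs_frameLevel_sub_le hK₁ _ _).trans (mul_le_mul_of_nonneg_left ?_ hK₁0)
    rw [show levelPoint μ K 0 (φ + θ) - pairDiffPath μ K ρ ϑ θ 0 - (levelPoint μ K 0 (φ + θ) - pairDiffPath μ K 0 π θ 0) = pairSumPath μ K ρ ϑ θ 0 by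
      rw [← pairDiffPath_pi_sub_eq_pairSumPath]; abel]
    exact norm_pairSumPath_zero_le hA hA20 hd hr hlo hhi hA₃ hA₄ hρ ϑ θ
  have step3 := abs_partnerBand_ph_tangency_sub_curv_le hA hA20 hd hr hlo hhi hA₃ hA₄ hK₁ hK₂ hK₃ θ φ
  have e1 : frameLevel μ K (levelPoint μ K e (φ + θ) - pairDiffPath μ K ρ ϑ θ 0) - φ ^ 2 * fderiv ℝ (fderiv ℝ (frameLevel μ K)) (levelPoint μ K 0 θ) (iteratedDeriv 1 (levelPoint μ K 0) θ) (iteratedDeriv 1 (levelPoint μ K 0) θ) =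
      (frameLevel μ K (levelPoint μ K e (φ + θ) - pairDiffPath μ K ρ ϑ θ 0) - frameLevel μ K (levelPoint μ K 0 (φ + θ) - pairDiffPath μ K ρ ϑ θ 0)) +
        (frameLevel μ K (levelPoint μ K 0 (φ + θ) - pairDiffPath μ K ρ ϑ θ 0) - frameLevel μ K (levelPoint μ K 0 (φ + θ) - pairDiffPath μ K 0 π θ 0)) +
        (frameLevel μ K (levelPoint μ K 0 (φ + θ) - pairDiffPath μ K 0 π θ 0) - φ ^ 2 * fderiv ℝ (fderiv ℝ (frameLevel μ K)) (levelPoint μ K 0 θ) (iteratedDeriv 1 (levelPoint μ K 0) θ) (iteratedDeriv 1 (levelPoint μ K 0) θ)) := by ring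
  rw [e1]
  refine (abs_add_three _ _ _).trans ?_
  linarith

/-- **LOWER BOUND OF THE pp PARTNER BAND NEAR TANGENCY under `FrameOK`**:
`(3/200)·u_min²·φ² − C₃|φ|³ − K₁|e|/d − K₁(|ρ|/d + D₁|ϑ|) ≤ |e_K(S_{ρ,ϑ,θ}(0) − Φ(e, φ+θ))|`. -/
theorem partnerBand_pp_tangency_lower {R : RenConsts} {U : ℝ} {N : ℕ} (hF : FrameOK R U N μ K) {ρ : ℝ} (hρ : |ρ| < r) {e : ℝ} (he : |e| < r) (ϑ θ φ : ℝ) :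
    3 / 200 * (bandBounds (show (-4 : ℝ) < -1.1 by norm_num) (show (-1.1 : ℝ) ≤ -0.1 by norm_num) (show (-0.1 : ℝ) < 0 by norm_num)).umin ^ 2 * φ ^ 2 -
          (K₃ * msD A₃ A₄ 1 ^ 3 + 3 * K₂ * msD A₃ A₄ 1 * msD A₃ A₄ 2 + K₁ * msD A₃ A₄ 3) * |φ| ^ 3 - K₁ * (|e| / ((bandBounds (show (-4 : ℝ) < -1.1 by norm_num) (show (-1.1 : ℝ) ≤ -0.1 by norm_num) (show (-0.1 : ℝ) < 0 by norm_num)).Dtmin - 2 * A)) -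
        K₁ * (|ρ| / ((bandBounds (show (-4 : ℝ) < -1.1 by norm_num) (show (-1.1 : ℝ) ≤ -0.1 by norm_num) (show (-0.1 : ℝ) < 0 by norm_num)).Dtmin - 2 * A) + msD A₃ A₄ 1 * |ϑ|) ≤
      |frameLevel μ K (pairSumPath μ K ρ ϑ θ 0 - levelPoint μ K e (φ + θ))| := by
  have h1 := abs_partnerBand_pp_sub_curv_le hA hA20 hd hr hlo hhi hA₃ hA₄ hK₁ hK₂ hK₃ hρ he ϑ θ φ
  have h2 := curvCoeff_ge_umin_sq_of_frameOK hA hd hr hlo hhi hF θ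
  have h3 : 3 / 200 * (bandBounds (show (-4 : ℝ) < -1.1 by norm_num) (show (-1.1 : ℝ) ≤ -0.1 by norm_num) (show (-0.1 : ℝ) < 0 by norm_num)).umin ^ 2 * φ ^ 2 ≤ φ ^ 2 * fderiv ℝ (fderiv ℝ (frameLevel μ K)) (levelPoint μ K 0 θ) (iteratedDeriv 1 (levelPoint μ K 0) θ) (iteratedDeriv 1 (levelPoint μ K 0) θ) := by
    rw [mul_comm (φ ^ 2)]; exact mul_le_mul_of_nonneg_right h2 (sq_nonneg φ)
  have tri := abs_sub_abs_le_abs_sub (φ ^ 2 * fderiv ℝ (fderiv ℝ (frameLevel μ K)) (levelPoint μ K 0 θ) (iteratedDeriv 1 (levelPoint μ K 0) θ) (iteratedDeriv 1 (levelPoint μ K 0) θ))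
    (frameLevel μ K (pairSumPath μ K ρ ϑ θ 0 - levelPoint μ K e (φ + θ)))
  rw [abs_sub_comm] at tri
  have h4 : 3 / 200 * (bandBounds (show (-4 : ℝ) < -1.1 by norm_num) (show (-1.1 : ℝ) ≤ -0.1 by norm_num) (show (-0.1 : ℝ) < 0 by norm_num)).umin ^ 2 * φ ^ 2 ≤ |φ ^ 2 * fderiv ℝ (fderiv ℝ (frameLevel μ K)) (levelPoint μ K 0 θ) (iteratedDeriv 1 (levelPoint μ K 0) θ) (iteratedDeriv 1 (levelPoint μ K 0) θ)| := h3.trans (le_abs_self _)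
  linarith

/-- **LOWER BOUND OF THE ph PARTNER BAND NEAR `2k_F` under `FrameOK`**:
`(3/200)·u_min²·φ² − C₃|φ|³ − K₁|e|/d − K₁(|ρ|/d + D₁|ϑ − π|) ≤ |e_K(Φ(e, φ+θ) − D_{ρ,ϑ,θ}(0))|`. -/
theorem partnerBand_ph_tangency_lower {R : RenConsts} {U : ℝ} {N : ℕ} (hF : FrameOK R U N μ K) {ρ : ℝ} (hρ : |ρ| < r) {e : ℝ} (he : |e| < r) (ϑ θ φ : ℝ) :
    3 / 200 * (bandBounds (show (-4 : ℝ) < -1.1 by norm_num) (show (-1.1 : ℝ) ≤ -0.1 by norm_num) (show (-0.1 : ℝ) < 0 by norm_num)).umin ^ 2 * φ ^ 2 -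
          (K₃ * msD A₃ A₄ 1 ^ 3 + 3 * K₂ * msD A₃ A₄ 1 * msD A₃ A₄ 2 + K₁ * msD A₃ A₄ 3) * |φ| ^ 3 - K₁ * (|e| / ((bandBounds (show (-4 : ℝ) < -1.1 by norm_num) (show (-1.1 : ℝ) ≤ -0.1 by norm_num) (show (-0.1 : ℝ) < 0 by norm_num)).Dtmin - 2 * A)) -
        K₁ * (|ρ| / ((bandBounds (show (-4 : ℝ) < -1.1 by norm_num) (show (-1.1 : ℝ) ≤ -0.1 by norm_num) (show (-0.1 : ℝ) < 0 by norm_num)).Dtmin - 2 * A) + msD A₃ A₄ 1 * |ϑ - π|) ≤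
      |frameLevel μ K (levelPoint μ K e (φ + θ) - pairDiffPath μ K ρ ϑ θ 0)| := by
  have h1 := abs_partnerBand_ph_sub_curv_le hA hA20 hd hr hlo hhi hA₃ hA₄ hK₁ hK₂ hK₃ hρ he ϑ θ φ
  have h2 := curvCoeff_ge_umin_sq_of_frameOK hA hd hr hlo hhi hF θ
  have h3 : 3 / 200 * (bandBounds (show (-4 : ℝ) < -1.1 by norm_num) (show (-1.1 : ℝ) ≤ -0.1 by norm_num) (show (-0.1 : ℝ) < 0 by norm_num)).umin ^ 2 * φ ^ 2 ≤ φ ^ 2 * fderiv ℝ (fderiv ℝ (frameLevel μ K)) (levelPoint μ K 0 θ) (iteratedDeriv 1 (levelPoint μ K 0) θ) (iteratedDeriv 1 (levelPoint μ K 0) θ) := by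
    rw [mul_comm (φ ^ 2)]; exact mul_le_mul_of_nonneg_right h2 (sq_nonneg φ)
  have tri := abs_sub_abs_le_abs_sub (φ ^ 2 * fderiv ℝ (fderiv ℝ (frameLevel μ K)) (levelPoint μ K 0 θ) (iteratedDeriv 1 (levelPoint μ K 0) θ) (iteratedDeriv 1 (levelPoint μ K 0) θ))
    (frameLevel μ K (levelPoint μ K e (φ + θ) - pairDiffPath μ K ρ ϑ θ 0))
  rw [abs_sub_comm] at tri
  have h4 : 3 / 200 * (bandBounds (show (-4 : ℝ) < -1.1 by norm_num) (show (-1.1 : ℝ) ≤ -0.1 by norm_num) (show (-0.1 : ℝ) < 0 by norm_num)).umin ^ 2 * φ ^ 2 ≤ |φ ^ 2 * fderiv ℝ (fderiv ℝ (frameLevel μ K)) (levelPoint μ K 0 θ) (iteratedDeriv 1 (levelPoint μ K 0) θ) (iteratedDeriv 1 (levelPoint μ K 0) θ)| := h3.trans (le_abs_self _)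
  linarith

end Sizes

end Summit.HubbardSuperconductivity.HubbardSuperconductivity.Theorems.C4a

end
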